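import Summits.ABC.StewartYu.PadicG3KStep
import Summits.ABC.StewartYu.PadicG3ValuesGen
import HarnessLib

/-!
# Cell abc-stewartyu, crux `Y07Odd` (stmt-ABC-19658), line `gen3-slab-odd`: the k-steps in CLASS-FREE form (hypothesis on `φ_τ(x)` at the nodes)
# and the SIGN-CLASS values `φ_τ(x) = g3φ(sgn^x · p)(x)` needed from level 1 on

`Summits/ABC/StewartYu/PadicG3KStepPhi.lean` — cell `abc-stewartyu` (design HOME/p2/HALFSTEP-ODD.md §LEVEL INVARIANT; seat p2-g4, F-odd lead).
Theorems on `G3Setup`; no named fact.  After the first Kummer half-step the exponent family lies in TWO twist classes `cls(vᵢ) = sgnᵢ ∈ {±1}`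
(the 2-torsion of `μ_{p−1}`), so the values at an integer `x` are `φ_τ(x) = g3φ(i ↦ sgnᵢ^{x}·pᵢ)(x)` (`g3Φ_intCast_pm`): the coefficient vector
seen by the Liouville step depends on the parity of `x`.  The extrapolation bounds are therefore restated with the hypothesis directly on the
values `φ_τ''(x) = 0` at the nodes (`norm_g3F_le_of_zerosΦ` — the landed proof verbatim; the odd-node twin is `PadicG3KStepPhiOdd`), and
the k-step `g3_kstep_pm` concludes `g3φ(sgn^{x₁}·p)(x₁) = 0` at the new points.

WHAT THIS IS NOT: no new analysis; no parameters; no crux moves.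

References: K. Yu, Compositio 74 (1990) §3 and (2.101)–(2.106) (the ± classes); Acta Arith. 89 (1999) §10; Yu 2013 Lemma 5.2.
-/

noncomputable section

open NormedSpace Finset IsUltrametricDist Polynomial Metric Filter
open Literature.NumberTheory.Transcendental
open Literature.NumberTheory.Transcendental.PadicCW77 (nodeSeq length_nodeSeq mem_nodeSeq count_nodeSeq
  countP_nodeSeq card_filter_range_mod_le condExp)
open Literature.NumberTheory.Transcendental.CW77.Setup (Tau tauNorm)
open scoped Nat Topology

namespace Summit.ABC.StewartYu

namespace G3Setup

variable {p : ℕ} [Fact p.Prime] (S : G3Setup p) {ι : Type*} (R : ι → ℚ[X]) (v : ι → Fin S.n → ℤ)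

/-! ### Values on two sign classes -/

/-- The sign-twisted coefficients at the point `x`: `pᵢ` for even `x`, `sgnᵢ·pᵢ` for odd `x`. [cite: Yu1990, (2.104); shape only] -/
def pvx (sgn pv : ι → ℤ) (x : ℤ) : ι → ℤ := fun i => sgn i ^ (x.natAbs % 2) * pv i

/-- `|pvx i| ≤ P` when `|pᵢ| ≤ P` and `sgnᵢ = ±1`. [folklore] -/
theorem abs_pvx_le {sgn pv : ι → ℤ} (hsgn : ∀ i, sgn i = 1 ∨ sgn i = -1) {P : ℤ} {i : ι} (hP : |pv i| ≤ P) (x : ℤ) :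
    |pvx sgn pv x i| ≤ P := by
  unfold pvx
  rw [abs_mul, abs_pow]
  rcases hsgn i with h | h <;> rw [h] <;> simp [hP]

/-- `pvx i ≠ 0 ↔ pᵢ ≠ 0` (`sgnᵢ = ±1`). [folklore] -/
theorem pvx_ne_zero_iff {sgn pv : ι → ℤ} (hsgn : ∀ i, sgn i = 1 ∨ sgn i = -1) (x : ℤ) (i : ι) :
    pvx sgn pv x i ≠ 0 ↔ pv i ≠ 0 := by
  unfold pvx
  have hs : sgn i ^ (x.natAbs % 2) ≠ 0 := pow_ne_zero _ (by rcases hsgn i with h | h <;> rw [h] <;> norm_num)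
  rw [mul_ne_zero_iff]
  exact ⟨fun h => h.2, fun h => ⟨hs, h⟩⟩

/-- **Values on two sign classes**: if `cls(vᵢ) = sgnᵢ ∈ {±1}` on `B`, then `φ_τ(x) = g3φ(pvx sgn p x)(x)` at every integer `x`.
[cite: Yu1990, (2.104); shape only] -/
theorem g3Φ_intCast_pm (B : Finset ι) (sgn : ι → ℤ) (hsgn : ∀ i, sgn i = 1 ∨ sgn i = -1)
    (hcls : ∀ i ∈ B, S.cls (v i) = (sgn i : ℚ_[p])) (pv : ι → ℤ) (τ : Tau S.n) (x : ℤ) :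
    S.g3Φ R v B pv τ (x : ℚ_[p]) = ((S.g3φ R v B (pvx sgn pv x) τ x : ℚ) : ℚ_[p]) := by
  unfold g3Φ g3φ pvx
  push_cast
  refine sum_congr rfl fun i hi => ?_
  unfold g3termΦ
  rw [hw_eval_intCast, mul_comm (S.Lsum (v i)), S.exp_intCast_mul_Lsum, S.prod_ω_zpow, hcls i hi]
  -- `sgnᵢ^x = sgnᵢ^{x mod 2}` for `sgnᵢ = ±1`
  have hsx : ((sgn i : ℤ) : ℚ_[p]) ^ x = ((sgn i : ℤ) : ℚ_[p]) ^ (x.natAbs % 2) := by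
    rcases hsgn i with h | h
    · rw [h]; push_cast; rw [one_zpow, one_pow]
    · rw [h]; push_cast
      rcases Int.even_or_odd x with hev | hodd
      · rw [Even.neg_one_zpow hev, Nat.even_iff.mp (Int.natAbs_even.mpr hev), pow_zero]
      · rw [Odd.neg_one_zpow hodd, Nat.odd_iff.mp (Int.natAbs_odd.mpr hodd), pow_one]
  rw [hsx]
  push_cast
  ring

/-! ### The extrapolation bounds with the hypothesis on `φ` at the nodes -/

/-- **The `p`-adic extrapolation bound for the class functions at the slab radius.**  CLASS-FREE form (hypothesis on the
values `φ_τ''(x)` themselves; depth-`m+1` exponents): if `φ_τ''(x) = 0` for all integers `|x| ≤ N` and all `|τ''| < Tlo`, the `Y₀`-weights satisfy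
`‖coeffₖ(hw i t₀)‖·(p^m√p)ᵏ ≤ Bw` and `‖Λ/b_{j₀}‖ ≤ p⁻¹`, then for `‖z‖ ≤ 1` and `|τ| + t ≤ Tlo` (`t ≥ 1`):
`‖f_τ(z)‖, ‖φ_τ(z)‖ ≤ max (Bw·‖Λ/b_{j₀}‖·p^{⌊(t−1)/2⌋}·p^{condExp p (2N+1) t}) (Bw / (p^m√p)^{(2N+1)·t})`.
[cite: Yu1999, §10] [cite: Yu1990, §3] [cite: Waldschmidt1980, Lemma 3.5] -/
theorem norm_g3F_le_of_zerosΦ (m : ℕ) (B : Finset ι) (hB : ∀ i ∈ B, ‖S.E (v i)‖ ≤ (p : ℝ)⁻¹ ^ (m + 1))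
    (pv : ι → ℤ) {N Tlo t : ℕ} (ht : 1 ≤ t)
    {Bw : ℝ} (hBw0 : 0 ≤ Bw) (hBw : ∀ i ∈ B, ∀ t₀ k, ‖(hw (p := p) R i t₀).coeff k‖ * ((p : ℝ) ^ m * Real.sqrt p) ^ k ≤ Bw)
    (hΛ : ‖S.Λ / (S.b S.j₀ : ℚ_[p])‖ ≤ (p : ℝ)⁻¹)
    (hzeroΦ : ∀ x : ℤ, |x| ≤ (N : ℤ) → ∀ τ'' : Tau S.n, tauNorm τ'' < Tlo → S.g3Φ R v B pv τ'' (x : ℚ_[p]) = 0)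
    {z : ℚ_[p]} (hz : ‖z‖ ≤ 1) (τ : Tau S.n) (hτ : tauNorm τ + t ≤ Tlo) :
    ‖S.g3F R v B pv τ z‖ ≤
        max (Bw * ‖S.Λ / (S.b S.j₀ : ℚ_[p])‖ * (p : ℝ) ^ ((t - 1) / 2) * (p : ℝ) ^ condExp p (2 * N + 1) t)
          (Bw / ((p : ℝ) ^ m * Real.sqrt p) ^ ((2 * N + 1) * t)) ∧
      ‖S.g3Φ R v B pv τ z‖ ≤
        max (Bw * ‖S.Λ / (S.b S.j₀ : ℚ_[p])‖ * (p : ℝ) ^ ((t - 1) / 2) * (p : ℝ) ^ condExp p (2 * N + 1) t)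
          (Bw / ((p : ℝ) ^ m * Real.sqrt p) ^ ((2 * N + 1) * t)) := by
  classical
  have hTlo : 1 ≤ Tlo := by omega
  have hprime : p.Prime := Fact.out
  have hp2 : p ≠ 2 := by have := S.hp3; omega
  have hp0 : (0 : ℝ) < p := S.p_pos
  have h1p : (1 : ℝ) ≤ p := S.one_lt_p.le
  set kpts : ℕ := 2 * N + 1 with hkpts
  set Pt : ℝ := (p : ℝ) ^ ((t - 1) / 2) with hPt
  set ρ : ℝ := (p : ℝ) ^ m * Real.sqrt p with hρdef
  have hρ : 0 < ρ := mul_pos (pow_pos hp0 m) S.sqrt_p_pos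
  have h1ρ : (1 : ℝ) < ρ := by
    have hs : 1 < Real.sqrt p := by
      rw [show (1 : ℝ) = Real.sqrt 1 by simp]
      exact Real.sqrt_lt_sqrt zero_le_one S.one_lt_p
    calc (1 : ℝ) = 1 * 1 := (mul_one 1).symm
      _ < ρ := mul_lt_mul' (one_le_pow₀ h1p) hs zero_le_one (pow_pos hp0 m)
  set δ : ℝ := ‖S.Λ / (S.b S.j₀ : ℚ_[p])‖ with hδ
  have hδ0 : 0 ≤ δ := norm_nonneg _
  -- (a) the `f − φ` comparison on the unit disc with `Q := Bw`
  have hQ : ∀ (τ' : Tau S.n) (z : ℚ_[p]), ‖z‖ ≤ 1 → ∀ i ∈ B, ‖(hw (p := p) R i τ'.1).eval z‖ ≤ Bw :=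
    fun τ' z hz i hi => S.norm_hw_eval_le_of_wt R m i τ'.1 hBw0 (hBw i hi τ'.1) hz
  have hFΦ : ∀ (τ' : Tau S.n) (z : ℚ_[p]), ‖z‖ ≤ 1 →
      ‖S.g3F R v B pv τ' z - S.g3Φ R v B pv τ' z‖ ≤ Bw * δ := fun τ' z hz =>
    S.norm_g3F_sub_g3Φ_le R v B pv τ' hz hΛ hBw0 (hQ τ' z hz)
  -- integers lie in the unit disc
  have hint : ∀ x : ℤ, ‖(x : ℚ_[p])‖ ≤ 1 := fun x => Padic.norm_int_le_one (p := p) x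
  -- the nodes `node i = i − N`, `i < 2N+1`
  set node : ℕ → ℚ_[p] := fun i => (((i : ℤ) - N : ℤ) : ℚ_[p]) with hnode
  have hnodeZ : ∀ i < kpts, |((i : ℤ) - N)| ≤ (N : ℤ) := by
    intro i hi; rw [abs_le]; constructor <;> omega
  -- (b) values at the nodes
  have hval : ∀ i < kpts, ∀ τ' : Tau S.n, tauNorm τ' ≤ Tlo - 1 → ‖S.g3F R v B pv τ' (node i)‖ ≤ Bw * δ := by
    intro i hi τ' hτ'
    have h0 : S.g3Φ R v B pv τ' (node i) = 0 := by
      simp only [hnode]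
      exact hzeroΦ _ (hnodeZ i hi) τ' (by omega)
    have := hFΦ τ' (node i) (by simp only [hnode]; exact hint _)
    rwa [h0, sub_zero] at this
  -- the coefficient sequence and its weighted bound
  set b : ℕ → ℚ_[p] := S.coeffG3F R v B pv τ with hb
  have hbB : PadicNewton.WtBdd ρ Bw b := S.wtBdd_coeffG3F R v m B hB pv τ hBw0 (fun i hi k => hBw i hi τ.1 k)
  -- the node set
  set nodes : Finset ℚ_[p] := (range kpts).image node with hnodes
  have hmem : ∀ a ∈ nodes, ∃ i < kpts, a = node i := by
    intro a ha
    obtain ⟨i, hi, rfl⟩ := mem_image.mp ha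
    exact ⟨i, mem_range.mp hi, rfl⟩
  have hnod : ∀ a ∈ nodes, ‖a‖ ≤ 1 := by
    intro a ha; obtain ⟨i, -, rfl⟩ := hmem a ha; simp only [hnode]; exact hint _
  -- differences of nodes are the integers `i − i'`
  have hdiff : ∀ i i' : ℕ, node i - node i' = (((i : ℤ) - i' : ℤ) : ℚ_[p]) := by
    intro i i'; simp only [hnode]; push_cast; ring
  -- the level structure: radii `R0 j = p^{-j}`, levels `Rl j = R0 (min j Jm)`, `Jm = ⌊log_p kpts⌋`
  set R0 : ℕ → ℝ := fun j => ((p : ℝ)⁻¹) ^ j with hR0def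
  have hR0pos : ∀ j, 0 < R0 j := fun j => by simp only [hR0def]; positivity
  have hR0anti : ∀ a b, a ≤ b → R0 b ≤ R0 a := fun a b hab => by
    simp only [hR0def]
    exact pow_le_pow_of_le_one (by positivity) (inv_le_one_of_one_le₀ h1p) hab
  have hR0ratio : ∀ j, R0 j / R0 (j + 1) = p := by
    intro j; simp only [hR0def, pow_succ]; field_simp
  have hR0zpow : ∀ j : ℕ, R0 j = (p : ℝ) ^ (-(j : ℤ)) := fun j => by
    simp only [hR0def, zpow_neg, zpow_natCast, inv_pow]
  set Jm : ℕ := Nat.log p kpts with hJm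
  set Rl : ℕ → ℝ := fun j => R0 (min j Jm) with hRl
  have hRl0 : Rl 0 = 1 := by simp [hRl, hR0def]
  have hRlpos : ∀ j, 0 < Rl j := fun j => hR0pos _
  have hRlanti : ∀ j, Rl (j + 1) ≤ Rl j := fun j => hR0anti _ _ (min_le_min (Nat.le_succ j) le_rfl)
  have hlev : ∀ a ∈ nodes, ∀ a' ∈ nodes, a ≠ a' → ∃ j < Jm + 1, ‖a - a'‖ = Rl j := by
    intro a ha a' ha' hne
    obtain ⟨i, hi, rfl⟩ := hmem a ha
    obtain ⟨i', hi', rfl⟩ := hmem a' ha'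
    set mm : ℤ := (i : ℤ) - i' with hmm
    have hm0 : mm ≠ 0 := by
      intro h0; apply hne
      have : (i : ℤ) = i' := by omega
      have : i = i' := by exact_mod_cast this
      simp only [hnode, this]
    have hmabs : mm.natAbs ≤ kpts := by omega
    have hdvd : p ^ padicValInt p mm ∣ mm.natAbs := by
      have h1 := Int.natAbs_dvd_natAbs.mpr (padicValInt_dvd (p := p) mm)
      simpa [Int.natAbs_pow] using h1
    have hvle : padicValInt p mm ≤ Jm := by
      have h2 : p ^ padicValInt p mm ≤ kpts := (Nat.le_of_dvd (Int.natAbs_pos.mpr hm0) hdvd).trans hmabs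
      exact Nat.le_log_of_pow_le hprime.one_lt h2
    refine ⟨padicValInt p mm, by omega, ?_⟩
    have hRv : Rl (padicValInt p mm) = R0 (padicValInt p mm) := by simp only [hRl, min_eq_left hvle]
    rw [hRv, hdiff, hR0zpow]
    have : ((mm : ℚ) : ℚ_[p]) = (mm : ℚ_[p]) := by push_cast; rfl
    rw [← this, Padic.norm_eq_zpow_neg_valuation (by exact_mod_cast hm0), Padic.valuation_ratCast,
      padicValRat.of_int]
  -- (c) the jets at the nodes (`‖1/k!‖ ≤ p^{⌊(k−1)/2⌋} ≤ Pt`)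
  set εj : ℝ := Bw * δ * Pt with hεj
  have hεj0 : 0 ≤ εj := by positivity
  have hjet : ∀ a ∈ nodes, ∀ k < t, ‖∑' n, PadicNewton.ddList (List.replicate k a) b n * a ^ n‖ ≤ εj := by
    intro a ha k hkt
    obtain ⟨i, hi, rfl⟩ := hmem a ha
    have hj := S.norm_jet_g3F_le R v m B hB pv hBw0 (by simp only [hnode]; exact hint _) (Tlo - 1)
      (by positivity) (fun τ' hτ' => hval i hi τ' hτ') k τ (fun i' hi' k' => hBw i' hi' τ.1 k') (by omega)
    change ‖PadicNewton.jet _ b k‖ ≤ εj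
    refine hj.trans ?_
    rw [hεj, mul_comm]
    refine mul_le_mul_of_nonneg_left ?_ (by positivity)
    refine (PadicExpOdd.norm_inv_natCast_factorial_padic_le (ℓ := p) hp2 k).trans (pow_le_pow_right₀ h1p ?_)
    exact Nat.div_le_div_right (by omega)
  -- the node sequence: each node `t` times
  have hcast_inj : Function.Injective node := by
    intro i i' hii'
    simp only [hnode] at hii'
    have h' : ((i : ℤ) - N : ℤ) = (i' : ℤ) - N := by exact_mod_cast (Int.cast_injective (α := ℚ_[p]) hii')
    have : (i : ℤ) = i' := by omega
    exact_mod_cast this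
  set xs : List ℚ_[p] := nodeSeq node kpts t with hxs
  have hxs_mem : ∀ x ∈ xs, x ∈ nodes := by
    intro x hx
    obtain ⟨i, hi, rfl⟩ := mem_nodeSeq hx
    exact mem_image.mpr ⟨i, by simpa using hi, rfl⟩
  have hxs_len : xs.length = kpts * t := length_nodeSeq node kpts t
  have hxs_cnt : ∀ a ∈ nodes, xs.count a ≤ t := by
    intro a ha
    obtain ⟨i, hi, rfl⟩ := hmem a ha
    rw [hxs, count_nodeSeq hcast_inj t kpts i, if_pos hi]
  -- (c') the conditioning: nodes within `p^{-j}` of `node i₀` agree with it mod `p^j`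
  have hball : ∀ j : ℕ, 1 ≤ j → PadicNewton.ballCount nodes (R0 j) xs ≤ t * (kpts / p ^ j + 1) := by
    intro j hj
    unfold PadicNewton.ballCount
    refine Finset.sup_le fun a ha => ?_
    obtain ⟨i₀, hi₀, rfl⟩ := hmem a ha
    rw [hxs, countP_nodeSeq]
    have hsub : ∀ i ∈ range kpts, decide (‖node i - node i₀‖ ≤ R0 j) = true → i % p ^ j = i₀ % p ^ j := by
      intro i _ hdec
      have hle : ‖node i - node i₀‖ ≤ R0 j := of_decide_eq_true hdec
      rw [hdiff, hR0zpow, Padic.norm_int_le_pow_iff_dvd] at hle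
      have hmod : i₀ ≡ i [MOD p ^ j] := Nat.modEq_iff_dvd.mpr (by push_cast; exact hle)
      exact hmod.symm
    calc ∑ i ∈ range kpts, (if decide (‖node i - node i₀‖ ≤ R0 j) = true then t else 0)
        ≤ ∑ i ∈ range kpts, (if i % p ^ j = i₀ % p ^ j then t else 0) := by
          refine sum_le_sum fun i hi => ?_
          by_cases hd : decide (‖node i - node i₀‖ ≤ R0 j) = true
          · rw [if_pos hd, if_pos (hsub i hi hd)]
          · rw [if_neg hd]; positivity
      _ = t * ((range kpts).filter fun i => i % p ^ j = i₀ % p ^ j).card := by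
          rw [← Finset.sum_filter]; simp [mul_comm]
      _ ≤ t * (kpts / p ^ j + 1) := Nat.mul_le_mul_left _ (card_filter_range_mod_le kpts _ _)
  have hcond : ∏ j ∈ range (Jm + 1), (Rl j / Rl (j + 1)) ^ PadicNewton.ballCount nodes (Rl (j + 1)) xs ≤
      (p : ℝ) ^ condExp p kpts t := by
    rw [Finset.prod_range_succ]
    have hlast : Rl Jm / Rl (Jm + 1) = 1 := by
      simp only [hRl, min_eq_left (le_refl Jm), min_eq_right (Nat.le_succ Jm), div_self (hR0pos _).ne']
    rw [hlast, one_pow, mul_one]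
    have hin : ∀ j ∈ range Jm, (Rl j / Rl (j + 1)) ^ PadicNewton.ballCount nodes (Rl (j + 1)) xs =
        (p : ℝ) ^ PadicNewton.ballCount nodes (R0 (j + 1)) xs := by
      intro j hj
      have hj' : j + 1 ≤ Jm := mem_range.mp hj
      simp only [hRl, min_eq_left (Nat.le_of_succ_le hj'), min_eq_left hj', hR0ratio]
    rw [Finset.prod_congr rfl hin, Finset.prod_pow_eq_pow_sum]
    refine pow_le_pow_right₀ h1p ?_
    have hJm' : Jm ≤ Nat.log p (2 * kpts) := Nat.log_mono_right (by omega)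
    unfold condExp
    calc ∑ j ∈ range Jm, PadicNewton.ballCount nodes (R0 (j + 1)) xs
        ≤ ∑ j ∈ range Jm, t * (kpts / p ^ (j + 1) + 1) := sum_le_sum fun j _ => hball (j + 1) (by omega)
      _ ≤ ∑ j ∈ range (Nat.log p (2 * kpts)), t * (kpts / p ^ (j + 1) + 1) :=
          sum_le_sum_of_subset_of_nonneg
            (fun j hj => mem_range.mpr (lt_of_lt_of_le (mem_range.mp hj) hJm')) fun _ _ _ => Nat.zero_le _
  -- (d) the small-jets Schwarz lemma (level version) at `z`
  have hschwarz := PadicNewton.norm_tsum_le_max_of_small_jets_levels hρ h1ρ le_rfl hbB nodes hnod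
    Rl hRl0 hRlpos hRlanti (Jm + 1) hlev hεj0 hjet xs hxs_mem hxs_cnt hz
  have hzlt : ‖z‖ < ρ := lt_of_le_of_lt hz h1ρ
  have hF : ‖S.g3F R v B pv τ z‖ ≤
      max (εj * ∏ j ∈ range (Jm + 1), (Rl j / Rl (j + 1)) ^ PadicNewton.ballCount nodes (Rl (j + 1)) xs)
        (Bw / ρ ^ xs.length * (xs.map fun x => ‖z - x‖).prod) := by
    rw [S.g3F_eq_tsum R v m B hB pv τ hzlt]; exact hschwarz
  have hprod : (xs.map fun x => ‖z - x‖).prod ≤ 1 := by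
    have h := List.prod_map_le_prod_map₀ (s := xs) (fun x => ‖z - x‖)
      (fun _ => (1 : ℝ)) (fun x _ => norm_nonneg _) (fun x hx => by
        rw [sub_eq_add_neg]
        exact (norm_add_le_max _ _).trans (max_le hz (by rw [norm_neg]; exact hnod x (hxs_mem x hx))))
    simpa using h
  have hterm1 : εj * ∏ j ∈ range (Jm + 1), (Rl j / Rl (j + 1)) ^ PadicNewton.ballCount nodes (Rl (j + 1)) xs ≤
      Bw * δ * Pt * (p : ℝ) ^ condExp p kpts t := mul_le_mul_of_nonneg_left hcond hεj0
  have hterm2 : Bw / ρ ^ xs.length * (xs.map fun x => ‖z - x‖).prod ≤ Bw / ρ ^ (kpts * t) := by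
    rw [hxs_len]
    exact mul_le_of_le_one_right (by positivity) hprod
  have hF' : ‖S.g3F R v B pv τ z‖ ≤ max (Bw * δ * Pt * (p : ℝ) ^ condExp p kpts t) (Bw / ρ ^ (kpts * t)) :=
    hF.trans (max_le_max hterm1 hterm2)
  refine ⟨hF', ?_⟩
  have e : S.g3Φ R v B pv τ z = S.g3F R v B pv τ z + -(S.g3F R v B pv τ z - S.g3Φ R v B pv τ z) := by ring
  rw [e]
  refine (norm_add_le_max _ _).trans (max_le hF' ?_)
  rw [norm_neg]
  refine (hFΦ τ _ hz).trans (le_max_of_le_left ?_)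
  have h1 : (1 : ℝ) ≤ Pt := one_le_pow₀ h1p
  have h2 : (1 : ℝ) ≤ (p : ℝ) ^ condExp p kpts t := one_le_pow₀ h1p
  calc Bw * δ = Bw * δ * 1 * 1 := by ring
    _ ≤ Bw * δ * Pt * (p : ℝ) ^ condExp p kpts t := by gcongr


/-! ### The k-step on two sign classes -/

/-- **The k-step on two sign classes** (symmetric nodes): zeros `φ_τ''(x) = 0` at `|x| ≤ N`, `|τ''| < Tlo`, the record's Liouville datum
(pointwise `M₀`) and inequality at the new points ⇒ `g3φ(pvx sgn p x₁)(x₁) = 0` for `|x₁| ≤ N'`, `|τ| + t ≤ Tlo`. [cite: Yu2013, Lemma 5.2] -/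
theorem g3_kstep_pm (m : ℕ) (B : Finset ι) (hB : ∀ i ∈ B, ‖S.E (v i)‖ ≤ (p : ℝ)⁻¹ ^ (m + 1))
    (sgn : ι → ℤ) (hsgn : ∀ i, sgn i = 1 ∨ sgn i = -1) (hcls : ∀ i ∈ B, S.cls (v i) = (sgn i : ℚ_[p]))
    (pv : ι → ℤ) {N N' Tlo t : ℕ} (ht : 1 ≤ t)
    {Bw : ℝ} (hBw0 : 0 ≤ Bw) (hBw : ∀ i ∈ B, ∀ t₀ k, ‖(hw (p := p) R i t₀).coeff k‖ * ((p : ℝ) ^ m * Real.sqrt p) ^ k ≤ Bw)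
    (hΛ : ‖S.Λ / (S.b S.j₀ : ℚ_[p])‖ ≤ (p : ℝ)⁻¹)
    (hzero : ∀ x : ℤ, |x| ≤ (N : ℤ) → ∀ τ'' : Tau S.n, tauNorm τ'' < Tlo → S.g3φ R v B (pvx sgn pv x) τ'' x = 0)
    {Dbox : Fin S.n → ℕ} (hv : ∀ i ∈ B, ∀ j, |v i j| ≤ (Dbox j : ℤ))
    (den₀ : ℤ → Tau S.n → ℕ) (hden₀ : ∀ x τ, 1 ≤ den₀ x τ) (M₀ : ℤ → Tau S.n → ℤ)
    (hR : ∀ (x : ℤ) (τ : Tau S.n), ∀ i ∈ B, ∃ z₀ : ℤ, (den₀ x τ : ℚ) * (hasseDeriv τ.1 (R i)).eval (x : ℚ) = z₀ ∧ |z₀| ≤ M₀ x τ)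
    {Xb : ℤ} (hX : ∀ i ∈ B, ∀ k, |S.𝔛 (v i) k| ≤ Xb) {P : ℤ} (hP : ∀ i ∈ B, |pv i| ≤ P)
    (K : ℤ → Tau S.n → ℝ) (hK0 : ∀ x τ, 0 < K x τ)
    (hK : ∀ (x : ℤ) (τ : Tau S.n), (B.card : ℝ) * P * (M₀ x τ * (Xb : ℝ) ^ (∑ k, τ.2 k) *
      ((MonomialDen.monDen S.α (S.boxExpG Dbox x) : ℝ)) ^ 2) ≤ K x τ)
    (hfinal : ∀ x₁ : ℤ, |x₁| ≤ (N' : ℤ) → ∀ τ : Tau S.n, tauNorm τ + t ≤ Tlo →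
      max (Bw * ‖S.Λ / (S.b S.j₀ : ℚ_[p])‖ * (p : ℝ) ^ ((t - 1) / 2) * (p : ℝ) ^ condExp p (2 * N + 1) t)
        (Bw / ((p : ℝ) ^ m * Real.sqrt p) ^ ((2 * N + 1) * t)) < 1 / K x₁ τ) :
    ∀ x₁ : ℤ, |x₁| ≤ (N' : ℤ) → ∀ τ : Tau S.n, tauNorm τ + t ≤ Tlo → S.g3φ R v B (pvx sgn pv x₁) τ x₁ = 0 := by
  intro x₁ hx₁ τ hτ
  have hz : ‖((x₁ : ℤ) : ℚ_[p])‖ ≤ 1 := Padic.norm_int_le_one (p := p) x₁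
  have hzeroΦ : ∀ x : ℤ, |x| ≤ (N : ℤ) → ∀ τ'' : Tau S.n, tauNorm τ'' < Tlo → S.g3Φ R v B pv τ'' (x : ℚ_[p]) = 0 := by
    intro x hx τ'' hτ''
    rw [S.g3Φ_intCast_pm R v B sgn hsgn hcls, hzero x hx τ'' hτ'', Rat.cast_zero]
  have hcore := (S.norm_g3F_le_of_zerosΦ R v m B hB pv ht hBw0 hBw hΛ hzeroΦ hz τ hτ).2
  rw [S.g3Φ_intCast_pm R v B sgn hsgn hcls] at hcore
  exact S.g3φ_eq_zero_of_norm_lt R v B (pvx sgn pv x₁) hv τ x₁ (hden₀ x₁ τ) (hR x₁ τ) hX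
    (fun i hi => abs_pvx_le hsgn (hP i hi) x₁) (hK x₁ τ) (hK0 x₁ τ) (lt_of_le_of_lt hcore (hfinal x₁ hx₁ τ hτ))

end G3Setup

end Summit.ABC.StewartYu

end
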